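import Summits.BirchSwinnertonDyer.BirchSwinnertonDyer.Theorems.TameQuarticSolventSolventPairLowerBoundPairGivenGoodFieldOfLower
import Summits.BirchSwinnertonDyer.BirchSwinnertonDyer.Theorems.TameQuarticSolventSolventPairLowerBoundKolyvaginTwistedUpperAnalyticHalfAnyMult
import HarnessLib

/-!
# Route `TameQuarticSolvent`, crux `SolventPairLowerBound` (stmt-BirchSwinnertonDyer-21391), line `birth` —
# v6's stub K2a-rest shrunk from the 71 classes «no odd multiplicative prime» to the 19 classes «no multiplicative
# prime», and the crux BY NAME from PUB⁸′ · K1⁻ · K2a-ES₀′ · K2a-rest₀ (a v7-shaped composition)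

HONEST FRAMING. Theorems only; helper (`--supports stmt-BirchSwinnertonDyer-21391`, width seat `bsd-wall-tqs-p1-w3`
gen 2), CONDITIONAL on the displayed hypotheses; credits nothing toward closing the item and proves neither
Euler-system half. BSD is not proved by any of this; no named fact is introduced.

WHAT. Skeleton v6 of line `birth` (lead tqs-p1 g3, `Cruxes/SolventPairLowerBound/Lines/birth.lean`) derives the
twisted-constituent stub K2a («KolyvaginTwistedUpperOverK») by cases on «`W` has an ODD multiplicative prime
`ℓ₀ ≠ 3`», leaving the Euler-system half K2a-ES₀ (`stub_kolyvaginUpperRankZeroOverK`, 3 462 classes) and K2a-rest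
(`stub_kolyvaginTwistedUpperOverK_noOddMult`, ≤ 71 classes). Width seat w2 gen 2 landed the analytic half at ANY
multiplicative prime `ℓ₀ ≠ 3`, the prime `2` included
(`exists_totallyPositive_oddAtThree_twist_L_ne_zero_of_friedbergHoffstein_anyMult`, file
`…KolyvaginTwistedUpperAnalyticHalfAnyMult.lean`, from the tree's named fact `…_realQuadratic_tameAtThree_anyMult`).
This file draws the consequences for the skeleton:
* `friedbergHoffstein_realQuadratic_tameAtThree_of_anyMult` — the odd-`ℓ₀` named fact of v6's PUB⁸ is implied by
  `…_anyMult` (so a v7 PUB needs `…_anyMult` and `…_noflip` only, still eight facts: PUB⁸′);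
* `kolyvaginTwistedUpperOverK_of_anyMult_of_ES0_of_noMult` — K2a (v5 text, all rows) from the analytic half, an
  Euler-system half K2a-ES₀′ («KolyvaginUpperRankZeroOverK» with `ℓ₀ ≠ 2` dropped: any multiplicative `ℓ₀ ≠ 3`; the
  Jacquet–Langlands place over `K` is the Steinberg place over `ℓ₀` either way, and the Euler-system content is the
  same) and K2a-rest₀ («KolyvaginTwistedUpperOverK» on the 19 classes with NO multiplicative prime: 28224e/f,
  152100cl/cv, 176400ji, 189225m, 324900cq/da/db/df/eb, 412164a/t, 426888ce, 435600em/eu/fm/ha/hd — their sign-flip /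
  discrete-series places are tabulated in `Cruxes/SolventPairLowerBound/PARITY-K2A-REST-w3.md`);
* `stub_kolyvaginUpperRankZeroOverK_of_ES0anyMult`, `stub_kolyvaginTwistedUpperOverK_noOddMult_of_ES0anyMult_of_noMult`
  — the two REGISTERED v6 stubs from K2a-ES₀′ and K2a-rest₀ (so a lead may re-cut v7 := PUB⁸′ · K1⁻ · K2a-ES₀′ ·
  K2a-rest₀ without touching the rest of the composition);
* `solventPairLowerBound_of_published_of_K1low_of_K2aES0anyMult_of_K2aRest0` — the crux BY NAME from PUB⁸′, K1⁻,
  K2a-ES₀′, K2a-rest₀ (w3's `solventPairLowerBound_of_published_of_K1low_of_K2a`, p582415), the one-line closer of a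
  v7-shaped route-level split in which the «rest» item carries 19 census classes instead of 71. CONDITIONAL;
  credits nothing.

References: S. Friedberg, J. Hoffstein, Ann. of Math. 142 (1995) Thm. B (1); S. Kobayashi, Math. Ann. 323 (2002)
Thm. 1.1; D. Rohrlich, Compositio Math. 87 (1993) (local root numbers at multiplicative places); T. Dokchitser,
V. Dokchitser, Ann. of Math. 172 (2010) Thm. 2.3; J. S. Milne, Invent. Math. 17 (1972) Thm. 1.
-/

-- D-0017: single-problem summit, so `Summit.BirchSwinnertonDyer.BirchSwinnertonDyer.…` repeats a namespace BY DESIGN.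
set_option linter.dupNamespace false

noncomputable section

open scoped Classical NumberField

open IsDedekindDomain NumberField WeierstrassCurve
open Literature.NumberTheory.EllipticCurves
open Literature.NumberTheory.EllipticCurves.ModularForms
open Literature.NumberTheory.EllipticCurves.Rank1Residual

namespace Summit.BirchSwinnertonDyer.BirchSwinnertonDyer.Theorems.SolventPairLowerBound

/-- **The odd-`ℓ₀` Friedberg–Hoffstein instance of v6's PUB⁸ is implied by the any-`ℓ₀` instance** (both named facts
of `NonvanishingTwistsRealQuadraticTameAtThree.lean`; the latter has the same hypotheses with `ℓ₀ ≠ 2` dropped and one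
more conjunct — the `2`-adic unramifiedness congruence, vacuous information for the consumer — in its conclusion).
So a re-cut PUB needs `…_anyMult` and `…_noflip` only. [cite: FriedbergHoffstein1995, Thm. B (1)] -/
theorem friedbergHoffstein_realQuadratic_tameAtThree_of_anyMult
    (hFH : friedbergHoffstein_exists_twist_ne_zero_realQuadratic_tameAtThree_anyMult) :
    friedbergHoffstein_exists_twist_ne_zero_realQuadratic_tameAtThree := by
  intro W _ hCM hw hj hIII ℓ₀ _ _ hℓ3 hℓ d hd hv hwd K _ _ θ₁ h2 hθ₁ 𝔮 h𝔮
  obtain ⟨β, hβpos, hβval, hunit, hnsq, -, hsq, hL, hL1⟩ :=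
    hFH W hCM hw hj hIII ℓ₀ hℓ3 hℓ d hd hv hwd K θ₁ h2 hθ₁ 𝔮 h𝔮
  exact ⟨β, hβpos, hβval, hunit, hnsq, hsq, hL, hL1⟩

/-- **K2a (v5 text, every row) from the any-`ℓ₀` analytic half, the Euler-system half K2a-ES₀′ and K2a-rest₀.**
K2a-ES₀′ is v6's «KolyvaginUpperRankZeroOverK» with the restriction `ℓ₀ ≠ 2` DROPPED (any multiplicative `ℓ₀ ≠ 3`:
the Euler-system statement is the same — `E′ = (W_K)^{(β)}` good supersingular at `𝔭 ∣ 3`, `L(E′/K,1) ≠ 0`, and a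
Steinberg place over `ℓ₀` for Jacquet–Langlands); K2a-rest₀ is v6's K2a-rest restricted further to the 19 census
classes with NO multiplicative prime. On the 3 514 classes with a multiplicative prime `Vβ` is the twist itself.
CONDITIONAL; credits nothing. [cite: FriedbergHoffstein1995, Thm. B (1)] [cite: Kobayashi2002, Thm. 1.1 (i), (ii)] -/
theorem kolyvaginTwistedUpperOverK_of_anyMult_of_ES0_of_noMult (hmod : exists_isNewformOf)
    (hFH : friedbergHoffstein_exists_twist_ne_zero_realQuadratic_tameAtThree_anyMult)
    (hFH' : friedbergHoffstein_exists_twist_ne_zero_realQuadratic_tameAtThree_noflip)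
    (K2aES0 :
      ∀ (W : WeierstrassCurve ℚ) [W.IsElliptic] [W.IsGloballyMinimal],
        ¬ W.HasCM → Addv W 3 → Summit.BirchSwinnertonDyer.Rank1Residual.Additive.SubTprime W 3 →
        W.analyticRank = 1 →
        (∃ (ℓ₀ : ℕ) (_ : Fact ℓ₀.Prime), ℓ₀ ≠ 3 ∧ W.HasMultiplicativeReductionAtPrime ℓ₀) →
        ∀ (d : ℤ), 0 < d → padicValInt 3 d = 1 →
        ∀ (K : Type) [Field K] [NumberField K] (θ₁ : K), Module.finrank ℚ K = 2 → θ₁ ^ 2 = (d : K) →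
        ∀ β : K,
          (∀ v : HeightOneSpectrum (𝓞 K), ((3 : ℕ) : 𝓞 K) ∈ v.asIdeal →
            ∃ k : ℤ, v.valuation K β = WithZero.exp (2 * k + 1)) →
          (∀ σ : K →+* ℝ, 0 < σ β) →
          ((W.baseChange K).quadraticTwist β).HasEntireLFunction →
          ((W.baseChange K).quadraticTwist β).entireLFunction 1 ≠ 0 →
          Finite (AddCommGroup.primaryComponent ((W.baseChange K).quadraticTwist β).sha 3) ∧
            ∃ qβ : ℚ, analyticSha ((W.baseChange K).quadraticTwist β) = (qβ : ℂ) ∧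
              (padicValNat 3
                  (Nat.card (AddCommGroup.primaryComponent ((W.baseChange K).quadraticTwist β).sha 3)) : ℤ) ≤
                padicValRat 3 qβ)
    (K2aRest0 :
      ∀ (W : WeierstrassCurve ℚ) [W.IsElliptic] [W.IsGloballyMinimal],
        ¬ W.HasCM → Addv W 3 → Summit.BirchSwinnertonDyer.Rank1Residual.Additive.SubTprime W 3 →
        W.analyticRank = 1 →
        ¬ (∃ (ℓ₀ : ℕ) (_ : Fact ℓ₀.Prime), ℓ₀ ≠ 3 ∧ W.HasMultiplicativeReductionAtPrime ℓ₀) →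
        ∀ (d : ℤ), 0 < d → padicValInt 3 d = 1 →
        ∀ (K : Type) [Field K] [NumberField K] (θ₁ : K), Module.finrank ℚ K = 2 → θ₁ ^ 2 = (d : K) →
          ∃ β : K,
            (∀ v : HeightOneSpectrum (𝓞 K), ((3 : ℕ) : 𝓞 K) ∈ v.asIdeal →
              ∃ k : ℤ, v.valuation K β = WithZero.exp (2 * k + 1)) ∧
            (∀ σ : K →+* ℝ, 0 < σ β) ∧
            ∃ (Vβ : WeierstrassCurve K) (_ : Vβ.IsElliptic),
              (∃ C : WeierstrassCurve.VariableChange K, C • (W.baseChange K).quadraticTwist β = Vβ) ∧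
              Vβ.HasEntireLFunction ∧
              Finite (AddCommGroup.primaryComponent Vβ.sha 3) ∧
              ∃ qβ : ℚ, analyticSha Vβ = (qβ : ℂ) ∧
                (padicValNat 3 (Nat.card (AddCommGroup.primaryComponent Vβ.sha 3)) : ℤ) ≤
                  padicValRat 3 qβ) :
    ∀ (W : WeierstrassCurve ℚ) [W.IsElliptic] [W.IsGloballyMinimal],
      ¬ W.HasCM → Addv W 3 → Summit.BirchSwinnertonDyer.Rank1Residual.Additive.SubTprime W 3 →
      W.analyticRank = 1 →
      ∀ (d : ℤ), 0 < d → padicValInt 3 d = 1 →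
      ∀ (K : Type) [Field K] [NumberField K] (θ₁ : K), Module.finrank ℚ K = 2 → θ₁ ^ 2 = (d : K) →
        ∃ β : K,
          (∀ v : HeightOneSpectrum (𝓞 K), ((3 : ℕ) : 𝓞 K) ∈ v.asIdeal →
            ∃ k : ℤ, v.valuation K β = WithZero.exp (2 * k + 1)) ∧
          (∀ σ : K →+* ℝ, 0 < σ β) ∧
          ∃ (Vβ : WeierstrassCurve K) (_ : Vβ.IsElliptic),
            (∃ C : WeierstrassCurve.VariableChange K, C • (W.baseChange K).quadraticTwist β = Vβ) ∧
            Vβ.HasEntireLFunction ∧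
            Finite (AddCommGroup.primaryComponent Vβ.sha 3) ∧
            ∃ qβ : ℚ, analyticSha Vβ = (qβ : ℂ) ∧
              (padicValNat 3 (Nat.card (AddCommGroup.primaryComponent Vβ.sha 3)) : ℤ) ≤
                padicValRat 3 qβ := by
  intro W _ _ hCM hadd hsub hr d hd0 hd K _ _ θ₁ h2 hθ₁
  by_cases hmult : ∃ (ℓ₀ : ℕ) (_ : Fact ℓ₀.Prime), ℓ₀ ≠ 3 ∧ W.HasMultiplicativeReductionAtPrime ℓ₀
  · obtain ⟨β, hval, hpos, hL, hL1⟩ :=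
      exists_totallyPositive_oddAtThree_twist_L_ne_zero_of_friedbergHoffstein_anyMult hmod hFH hFH'
        W hCM hadd hsub hr hmult d hd0 hd K θ₁ h2 hθ₁
    obtain ⟨hfin, qβ, hqβ, hle⟩ := K2aES0 W hCM hadd hsub hr hmult d hd0 hd K θ₁ h2 hθ₁ β hval hpos hL hL1
    have hβ0 : β ≠ 0 := by
      intro h0
      obtain ⟨v, hv⟩ := exists_heightOneSpectrum_natCast_mem K 3
      obtain ⟨k, hk⟩ := hval v hv
      rw [h0, map_zero] at hk
      exact WithZero.exp_ne_zero hk.symm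
    haveI : (W.baseChange K).IsElliptic := by rw [WeierstrassCurve.baseChange]; infer_instance
    haveI : NeZero (2 : K) := ⟨two_ne_zero⟩
    exact ⟨β, hval, hpos, (W.baseChange K).quadraticTwist β, isElliptic_quadraticTwist _ hβ0,
      ⟨1, one_smul _ _⟩, hL, hfin, qβ, hqβ, hle⟩
  · exact K2aRest0 W hCM hadd hsub hr hmult d hd0 hd K θ₁ h2 hθ₁

/-- **v6's registered K2a-ES₀ (`stub_kolyvaginUpperRankZeroOverK`, odd `ℓ₀`) from K2a-ES₀′ (any multiplicative
`ℓ₀ ≠ 3`)** — a weakening of the hypothesis on `W`, verbatim otherwise. [folklore] -/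
theorem stub_kolyvaginUpperRankZeroOverK_of_ES0anyMult
    (K2aES0 :
      ∀ (W : WeierstrassCurve ℚ) [W.IsElliptic] [W.IsGloballyMinimal],
        ¬ W.HasCM → Addv W 3 → Summit.BirchSwinnertonDyer.Rank1Residual.Additive.SubTprime W 3 →
        W.analyticRank = 1 →
        (∃ (ℓ₀ : ℕ) (_ : Fact ℓ₀.Prime), ℓ₀ ≠ 3 ∧ W.HasMultiplicativeReductionAtPrime ℓ₀) →
        ∀ (d : ℤ), 0 < d → padicValInt 3 d = 1 →
        ∀ (K : Type) [Field K] [NumberField K] (θ₁ : K), Module.finrank ℚ K = 2 → θ₁ ^ 2 = (d : K) →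
        ∀ β : K,
          (∀ v : HeightOneSpectrum (𝓞 K), ((3 : ℕ) : 𝓞 K) ∈ v.asIdeal →
            ∃ k : ℤ, v.valuation K β = WithZero.exp (2 * k + 1)) →
          (∀ σ : K →+* ℝ, 0 < σ β) →
          ((W.baseChange K).quadraticTwist β).HasEntireLFunction →
          ((W.baseChange K).quadraticTwist β).entireLFunction 1 ≠ 0 →
          Finite (AddCommGroup.primaryComponent ((W.baseChange K).quadraticTwist β).sha 3) ∧
            ∃ qβ : ℚ, analyticSha ((W.baseChange K).quadraticTwist β) = (qβ : ℂ) ∧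
              (padicValNat 3
                  (Nat.card (AddCommGroup.primaryComponent ((W.baseChange K).quadraticTwist β).sha 3)) : ℤ) ≤
                padicValRat 3 qβ) :
    ∀ (W : WeierstrassCurve ℚ) [W.IsElliptic] [W.IsGloballyMinimal],
      ¬ W.HasCM → Addv W 3 → Summit.BirchSwinnertonDyer.Rank1Residual.Additive.SubTprime W 3 →
      W.analyticRank = 1 →
      (∃ (ℓ₀ : ℕ) (_ : Fact ℓ₀.Prime), ℓ₀ ≠ 2 ∧ ℓ₀ ≠ 3 ∧ W.HasMultiplicativeReductionAtPrime ℓ₀) →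
      ∀ (d : ℤ), 0 < d → padicValInt 3 d = 1 →
      ∀ (K : Type) [Field K] [NumberField K] (θ₁ : K), Module.finrank ℚ K = 2 → θ₁ ^ 2 = (d : K) →
      ∀ β : K,
        (∀ v : HeightOneSpectrum (𝓞 K), ((3 : ℕ) : 𝓞 K) ∈ v.asIdeal →
          ∃ k : ℤ, v.valuation K β = WithZero.exp (2 * k + 1)) →
        (∀ σ : K →+* ℝ, 0 < σ β) →
        ((W.baseChange K).quadraticTwist β).HasEntireLFunction →
        ((W.baseChange K).quadraticTwist β).entireLFunction 1 ≠ 0 →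
        Finite (AddCommGroup.primaryComponent ((W.baseChange K).quadraticTwist β).sha 3) ∧
          ∃ qβ : ℚ, analyticSha ((W.baseChange K).quadraticTwist β) = (qβ : ℂ) ∧
            (padicValNat 3
                (Nat.card (AddCommGroup.primaryComponent ((W.baseChange K).quadraticTwist β).sha 3)) : ℤ) ≤
              padicValRat 3 qβ := by
  intro W _ _ hCM hadd hsub hr hmult
  obtain ⟨ℓ₀, hℓp, -, hℓ3, hℓ⟩ := hmult
  exact K2aES0 W hCM hadd hsub hr ⟨ℓ₀, hℓp, hℓ3, hℓ⟩

/-- **v6's registered K2a-rest (`stub_kolyvaginTwistedUpperOverK_noOddMult`, ≤ 71 classes) from K2a-ES₀′ and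
K2a-rest₀ (19 classes)** — GIVEN modularity and the two Friedberg–Hoffstein-over-`K` named facts: on the 52 classes
whose only multiplicative prime is `2` the analytic half flips the sign at a place over `2` and K2a-ES₀′ supplies the
Euler-system half (with `Vβ` the twist itself); on the 19 classes without multiplicative prime it is K2a-rest₀.
CONDITIONAL; credits nothing. [cite: FriedbergHoffstein1995, Thm. B (1)] -/
theorem stub_kolyvaginTwistedUpperOverK_noOddMult_of_ES0anyMult_of_noMult (hmod : exists_isNewformOf)
    (hFH : friedbergHoffstein_exists_twist_ne_zero_realQuadratic_tameAtThree_anyMult)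
    (hFH' : friedbergHoffstein_exists_twist_ne_zero_realQuadratic_tameAtThree_noflip)
    (K2aES0 :
      ∀ (W : WeierstrassCurve ℚ) [W.IsElliptic] [W.IsGloballyMinimal],
        ¬ W.HasCM → Addv W 3 → Summit.BirchSwinnertonDyer.Rank1Residual.Additive.SubTprime W 3 →
        W.analyticRank = 1 →
        (∃ (ℓ₀ : ℕ) (_ : Fact ℓ₀.Prime), ℓ₀ ≠ 3 ∧ W.HasMultiplicativeReductionAtPrime ℓ₀) →
        ∀ (d : ℤ), 0 < d → padicValInt 3 d = 1 →
        ∀ (K : Type) [Field K] [NumberField K] (θ₁ : K), Module.finrank ℚ K = 2 → θ₁ ^ 2 = (d : K) →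
        ∀ β : K,
          (∀ v : HeightOneSpectrum (𝓞 K), ((3 : ℕ) : 𝓞 K) ∈ v.asIdeal →
            ∃ k : ℤ, v.valuation K β = WithZero.exp (2 * k + 1)) →
          (∀ σ : K →+* ℝ, 0 < σ β) →
          ((W.baseChange K).quadraticTwist β).HasEntireLFunction →
          ((W.baseChange K).quadraticTwist β).entireLFunction 1 ≠ 0 →
          Finite (AddCommGroup.primaryComponent ((W.baseChange K).quadraticTwist β).sha 3) ∧
            ∃ qβ : ℚ, analyticSha ((W.baseChange K).quadraticTwist β) = (qβ : ℂ) ∧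
              (padicValNat 3
                  (Nat.card (AddCommGroup.primaryComponent ((W.baseChange K).quadraticTwist β).sha 3)) : ℤ) ≤
                padicValRat 3 qβ)
    (K2aRest0 :
      ∀ (W : WeierstrassCurve ℚ) [W.IsElliptic] [W.IsGloballyMinimal],
        ¬ W.HasCM → Addv W 3 → Summit.BirchSwinnertonDyer.Rank1Residual.Additive.SubTprime W 3 →
        W.analyticRank = 1 →
        ¬ (∃ (ℓ₀ : ℕ) (_ : Fact ℓ₀.Prime), ℓ₀ ≠ 3 ∧ W.HasMultiplicativeReductionAtPrime ℓ₀) →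
        ∀ (d : ℤ), 0 < d → padicValInt 3 d = 1 →
        ∀ (K : Type) [Field K] [NumberField K] (θ₁ : K), Module.finrank ℚ K = 2 → θ₁ ^ 2 = (d : K) →
          ∃ β : K,
            (∀ v : HeightOneSpectrum (𝓞 K), ((3 : ℕ) : 𝓞 K) ∈ v.asIdeal →
              ∃ k : ℤ, v.valuation K β = WithZero.exp (2 * k + 1)) ∧
            (∀ σ : K →+* ℝ, 0 < σ β) ∧
            ∃ (Vβ : WeierstrassCurve K) (_ : Vβ.IsElliptic),
              (∃ C : WeierstrassCurve.VariableChange K, C • (W.baseChange K).quadraticTwist β = Vβ) ∧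
              Vβ.HasEntireLFunction ∧
              Finite (AddCommGroup.primaryComponent Vβ.sha 3) ∧
              ∃ qβ : ℚ, analyticSha Vβ = (qβ : ℂ) ∧
                (padicValNat 3 (Nat.card (AddCommGroup.primaryComponent Vβ.sha 3)) : ℤ) ≤
                  padicValRat 3 qβ) :
    ∀ (W : WeierstrassCurve ℚ) [W.IsElliptic] [W.IsGloballyMinimal],
      ¬ W.HasCM → Addv W 3 → Summit.BirchSwinnertonDyer.Rank1Residual.Additive.SubTprime W 3 →
      W.analyticRank = 1 →
      ¬ (∃ (ℓ₀ : ℕ) (_ : Fact ℓ₀.Prime), ℓ₀ ≠ 2 ∧ ℓ₀ ≠ 3 ∧ W.HasMultiplicativeReductionAtPrime ℓ₀) →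
      ∀ (d : ℤ), 0 < d → padicValInt 3 d = 1 →
      ∀ (K : Type) [Field K] [NumberField K] (θ₁ : K), Module.finrank ℚ K = 2 → θ₁ ^ 2 = (d : K) →
        ∃ β : K,
          (∀ v : HeightOneSpectrum (𝓞 K), ((3 : ℕ) : 𝓞 K) ∈ v.asIdeal →
            ∃ k : ℤ, v.valuation K β = WithZero.exp (2 * k + 1)) ∧
          (∀ σ : K →+* ℝ, 0 < σ β) ∧
          ∃ (Vβ : WeierstrassCurve K) (_ : Vβ.IsElliptic),
            (∃ C : WeierstrassCurve.VariableChange K, C • (W.baseChange K).quadraticTwist β = Vβ) ∧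
            Vβ.HasEntireLFunction ∧
            Finite (AddCommGroup.primaryComponent Vβ.sha 3) ∧
            ∃ qβ : ℚ, analyticSha Vβ = (qβ : ℂ) ∧
              (padicValNat 3 (Nat.card (AddCommGroup.primaryComponent Vβ.sha 3)) : ℤ) ≤
                padicValRat 3 qβ :=
  fun W _ _ hCM hadd hsub hr _ ↦
    kolyvaginTwistedUpperOverK_of_anyMult_of_ES0_of_noMult hmod hFH hFH' K2aES0 K2aRest0 W hCM hadd hsub hr

/-- **Crux `SolventPairLowerBound` BY NAME from PUB⁸′, K1⁻, K2a-ES₀′ and K2a-rest₀** (PUB⁸′ = v6's PUB⁸ with the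
odd-`ℓ₀` Friedberg–Hoffstein instance replaced by the any-`ℓ₀` one): w3's
`solventPairLowerBound_of_published_of_K1low_of_K2a` (p582415) fed by
`kolyvaginTwistedUpperOverK_of_anyMult_of_ES0_of_noMult`. The one-line closer of a v7-shaped route-level split
`21391 ⇐ K1⁻ · K2a-ES₀′ · K2a-rest₀ (+ PUB⁸′ by name)`, in which the «rest» item carries 19 census classes instead
of 71. CONDITIONAL on all hypotheses; credits nothing toward closing the item.
[cite: DokchitserDokchitserAnnals2010, §2.1 Thm. 2.3] [cite: FriedbergHoffstein1995, Thm. B (1)]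
[cite: GrossZagier1986, Thm. I.(7.3)] [cite: Milne1972ArithmeticAV, §1 Thm. 1] -/
theorem solventPairLowerBound_of_published_of_K1low_of_K2aES0anyMult_of_K2aRest0
    (hPUB :
      exists_isNewformOf ∧ nonempty_modularParametrizationData ∧ GrossZagier1986_thm_I_7_3 ∧
        rank_eq_analyticRank_of_analyticRank_le_one ∧
        Milne1972.bsdQuotientP_baseChange_relQuadratic_anyModel ∧
        friedbergHoffstein_exists_pos_twist_ne_zero_ramifiedAtThree ∧
        friedbergHoffstein_exists_twist_ne_zero_realQuadratic_tameAtThree_anyMult ∧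
        friedbergHoffstein_exists_twist_ne_zero_realQuadratic_tameAtThree_noflip)
    (K1low :
      ∀ (W : WeierstrassCurve ℚ) [W.IsElliptic] [W.IsGloballyMinimal],
        ¬ W.HasCM → Addv W 3 → Summit.BirchSwinnertonDyer.Rank1Residual.Additive.SubTprime W 3 →
        W.analyticRank = 1 →
        ∀ (K : Type) [Field K] [NumberField K] (M : Type) [Field M] [NumberField M] [Algebra K M],
          Module.finrank ℚ K = 2 → Module.finrank K M = 2 → IsTotallyReal M →
          (∀ w : HeightOneSpectrum (𝓞 M), ((3 : ℕ) : 𝓞 M) ∈ w.asIdeal →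
            w.asIdeal.ramificationIdx ℤ = 4) →
          (∀ w : HeightOneSpectrum (𝓞 M), ((3 : ℕ) : 𝓞 M) ∈ w.asIdeal →
            (W.baseChange M).HasGoodReductionAt w) →
          Finite (AddCommGroup.primaryComponent (W.baseChange M).sha 3) →
          ∀ qM : ℚ, analyticSha (W.baseChange M) = (qM : ℂ) →
            padicValRat 3 qM ≤
              padicValNat 3 (Nat.card (AddCommGroup.primaryComponent (W.baseChange M).sha 3)))
    (K2aES0 :
      ∀ (W : WeierstrassCurve ℚ) [W.IsElliptic] [W.IsGloballyMinimal],
        ¬ W.HasCM → Addv W 3 → Summit.BirchSwinnertonDyer.Rank1Residual.Additive.SubTprime W 3 →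
        W.analyticRank = 1 →
        (∃ (ℓ₀ : ℕ) (_ : Fact ℓ₀.Prime), ℓ₀ ≠ 3 ∧ W.HasMultiplicativeReductionAtPrime ℓ₀) →
        ∀ (d : ℤ), 0 < d → padicValInt 3 d = 1 →
        ∀ (K : Type) [Field K] [NumberField K] (θ₁ : K), Module.finrank ℚ K = 2 → θ₁ ^ 2 = (d : K) →
        ∀ β : K,
          (∀ v : HeightOneSpectrum (𝓞 K), ((3 : ℕ) : 𝓞 K) ∈ v.asIdeal →
            ∃ k : ℤ, v.valuation K β = WithZero.exp (2 * k + 1)) →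
          (∀ σ : K →+* ℝ, 0 < σ β) →
          ((W.baseChange K).quadraticTwist β).HasEntireLFunction →
          ((W.baseChange K).quadraticTwist β).entireLFunction 1 ≠ 0 →
          Finite (AddCommGroup.primaryComponent ((W.baseChange K).quadraticTwist β).sha 3) ∧
            ∃ qβ : ℚ, analyticSha ((W.baseChange K).quadraticTwist β) = (qβ : ℂ) ∧
              (padicValNat 3
                  (Nat.card (AddCommGroup.primaryComponent ((W.baseChange K).quadraticTwist β).sha 3)) : ℤ) ≤
                padicValRat 3 qβ)
    (K2aRest0 :
      ∀ (W : WeierstrassCurve ℚ) [W.IsElliptic] [W.IsGloballyMinimal],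
        ¬ W.HasCM → Addv W 3 → Summit.BirchSwinnertonDyer.Rank1Residual.Additive.SubTprime W 3 →
        W.analyticRank = 1 →
        ¬ (∃ (ℓ₀ : ℕ) (_ : Fact ℓ₀.Prime), ℓ₀ ≠ 3 ∧ W.HasMultiplicativeReductionAtPrime ℓ₀) →
        ∀ (d : ℤ), 0 < d → padicValInt 3 d = 1 →
        ∀ (K : Type) [Field K] [NumberField K] (θ₁ : K), Module.finrank ℚ K = 2 → θ₁ ^ 2 = (d : K) →
          ∃ β : K,
            (∀ v : HeightOneSpectrum (𝓞 K), ((3 : ℕ) : 𝓞 K) ∈ v.asIdeal →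
              ∃ k : ℤ, v.valuation K β = WithZero.exp (2 * k + 1)) ∧
            (∀ σ : K →+* ℝ, 0 < σ β) ∧
            ∃ (Vβ : WeierstrassCurve K) (_ : Vβ.IsElliptic),
              (∃ C : WeierstrassCurve.VariableChange K, C • (W.baseChange K).quadraticTwist β = Vβ) ∧
              Vβ.HasEntireLFunction ∧
              Finite (AddCommGroup.primaryComponent Vβ.sha 3) ∧
              ∃ qβ : ℚ, analyticSha Vβ = (qβ : ℂ) ∧
                (padicValNat 3 (Nat.card (AddCommGroup.primaryComponent Vβ.sha 3)) : ℤ) ≤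
                  padicValRat 3 qβ) :
    Summit.BirchSwinnertonDyer.BirchSwinnertonDyer.Theses.TameQuarticSolvent.SolventPairLowerBound :=
  solventPairLowerBound_of_published_of_K1low_of_K2a hPUB.1 hPUB.2.1 hPUB.2.2.1 hPUB.2.2.2.1 hPUB.2.2.2.2.1
    hPUB.2.2.2.2.2.1 K1low
    (kolyvaginTwistedUpperOverK_of_anyMult_of_ES0_of_noMult hPUB.1 hPUB.2.2.2.2.2.2.1 hPUB.2.2.2.2.2.2.2
      K2aES0 K2aRest0)

end Summit.BirchSwinnertonDyer.BirchSwinnertonDyer.Theorems.SolventPairLowerBound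

end
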